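import Summits.RiemannHypothesis.RiemannHypothesis.Theorems.TiltedLandingLaw421R3SinkThin
import Summits.RiemannHypothesis.RiemannHypothesis.Theorems.TiltedLandingLaw421R3SinkMirror

/-!
# W-08 law421 line — regime 3′ SINK: the THIN-STRIP CERTIFICATE CLAIMS (E2 text of record) and the reflection `ThinMirrorSig` PROVED («SinkThinSig», C1 rh-idea-5 g41; support, K-image — namespace `RhW08.SinkThin` continued, so every name keeps its sketch-of-record spelling

The (β′) «thin» targets over «SinkThin»'s `ThinStrip` / `KernelDomThin` / `ThinCone`: `CertificatesExistThinSig lam` = E2 TEXT OF RECORD (CA1104)(1)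
(102's `CertificatesExistSig lam` with the frame's zero-height bound `Hs`, `0 ≤ Hs`, the ONE binder `2·(Hs + h) ≤ R`, and kernel domination asked only
on the THIN far strip of lid height `Hs`) and its right-children half `CertificatesExistRightThinSig lam` (117's `CertificatesExistRightSig` likewise);
the restrictions from the max-strip claims (`certificatesExistThinSig_of_max`, `certificatesExistRightThinSig_of_right`: thin ⊆ max since `Hs ≤ R/2`);
and 117 «SinkMirror»'s reflection argument on the thin strip — the thin strip and its boundary are mirror-symmetric about the axis
(`thinStrip_mirror_iff`, `thinStripBdry_mirror_iff`, `kernelDomThin_mirror`, `kernelDomThinBdry_mirror`), whence ★ `certificatesExistThinSig_of_right :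
CertificatesExistRightThinSig lam → CertificatesExistThinSig lam` and the named implication `thinMirrorSig : ThinMirrorSig lam`.
All (K), sorry-free.  Both Sigs are conjecture-shaped `def`s ASSERTED BY NOTHING in this file; RH is not proved here or anywhere in this line;
⟨33346⟩/⟨33347⟩ are OPEN; checked ≠ keyed ≠ landed ≠ proved.
-/

namespace RhW08.SinkThin

open Complex
open scoped ComplexConjugate
open RhW08.SinkTemplate RhW08.SinkBdry RhW08.SinkConePos RhW08.SinkMirror

/-! ## §4 The thin-strip certificate claims (RESTATE-β′ targets) and their restriction from the max-strip claims -/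

/-- THE THIN-STRIP CLAIM for exponent `lam` (OPEN; the (β′) «thin» target, E2 of the edit list (CA1096)/(CA1103): numerically `lam = √5/2` with ONE
datum-determined tilted foot read, margin ≥ +10 %, ratio-flat — C3 JOINT-SCAN-2): 102's `CertificatesExistSig lam` with the frame's zero-height bound `Hs`
(`0 ≤ Hs`, `EngineHyps5` conjunct 8) and the ONE binder where supplier and consumer meet, **`2·(Hs + h) ≤ R`** (h the window cap): it gives the consumer
`Hs ≤ R/2` (thin ⊆ max) and the supplier `|Re w − xv| + Hs ≤ R/2` for every legal datum, whence `ThinCone` (`thinCone_of_datum`) and `c > 0` on the whole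
thin strip; kernel domination is asked only on the THIN far strip of lid height `Hs`.  At the Ξ frame of `closes` (Hs = hmax = 1/2, R = 135) the binder
is `2·(1/2 + 1/2) ≤ 135`. -/
def CertificatesExistThinSig (lam : ℝ) : Prop :=
  ∀ (xv R s h Hs : ℝ) (v w : ℂ) (mult : ℕ),
    0 < s → 2 * s ≤ h → 3 * h < R → 0 ≤ Hs → 2 * (Hs + h) ≤ R → v.re = xv → 0 < v.im → v.im ≤ h →
    0 < w.im → w.im < v.im → v.im - s / 4 < w.im → (w.re - xv) ^ 2 + w.im ^ 2 ≤ v.im ^ 2 → 1 ≤ mult →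
    ∃ (n : ℕ) (cs : Fin n → Cut) (σ : ℝ), CutsAdmissible xv cs ∧ (∀ k, (cs k).p = ⟨xv, w.im⟩ ∨ (cs k).p = ⟨xv, h⟩) ∧
      KernelDomThin xv R Hs cs w σ ∧
      DatumAlt lam s ‖farPairK v w‖ cs (-((mult : ℂ) * farPairK v w)) σ

/-- the same RESTRICTED to right children `xv ≤ Re w` (117's `CertificatesExistRightSig` shape; reflection gives all children as in 117 — `ThinMirrorSig`). -/
def CertificatesExistRightThinSig (lam : ℝ) : Prop :=
  ∀ (xv R s h Hs : ℝ) (v w : ℂ) (mult : ℕ),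
    0 < s → 2 * s ≤ h → 3 * h < R → 0 ≤ Hs → 2 * (Hs + h) ≤ R → v.re = xv → 0 < v.im → v.im ≤ h →
    0 < w.im → w.im < v.im → v.im - s / 4 < w.im → (w.re - xv) ^ 2 + w.im ^ 2 ≤ v.im ^ 2 → 1 ≤ mult → xv ≤ w.re →
    ∃ (n : ℕ) (cs : Fin n → Cut) (σ : ℝ), CutsAdmissible xv cs ∧ (∀ k, (cs k).p = ⟨xv, w.im⟩ ∨ (cs k).p = ⟨xv, h⟩) ∧
      KernelDomThin xv R Hs cs w σ ∧
      DatumAlt lam s ‖farPairK v w‖ cs (-((mult : ℂ) * farPairK v w)) σ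

/-- ★ RESTRICTION: the max-strip claim implies the thin claim (every landed max-strip certificate restricts; the thin claim is the WEAKER target). -/
theorem certificatesExistThinSig_of_max (lam : ℝ) (h : CertificatesExistSig lam) : CertificatesExistThinSig lam := by
  intro xv R s hh Hs v w mult hs hsh h3 hHs0 hHR hv hY hYh ht htY hdrop hnest hmult
  obtain ⟨n, cs, σ, hadm, hp, hK, hD⟩ := h xv R s hh v w mult hs hsh h3 hv hY hYh ht htY hdrop hnest hmult
  have hHs : Hs ≤ R / 2 := by linarith
  exact ⟨n, cs, σ, hadm, hp, kernelDomThin_of_kernelDom hHs hK, hD⟩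

/-- … and 117's right-children claim implies the thin right-children claim. -/
theorem certificatesExistRightThinSig_of_right (lam : ℝ) (h : CertificatesExistRightSig lam) : CertificatesExistRightThinSig lam := by
  intro xv R s hh Hs v w mult hs hsh h3 hHs0 hHR hv hY hYh ht htY hdrop hnest hmult hright
  obtain ⟨n, cs, σ, hadm, hp, hK, hD⟩ := h xv R s hh v w mult hs hsh h3 hv hY hYh ht htY hdrop hnest hmult hright
  have hHs : Hs ≤ R / 2 := by linarith
  exact ⟨n, cs, σ, hadm, hp, kernelDomThin_of_kernelDom hHs hK, hD⟩


/-- all children from right children on the thin strip is 117's reflection argument with `ThinStrip` in place of `MaxStrip` (the thin strip is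
mirror-symmetric about the axis); recorded as a named implication; PROVED below (§7, `thinMirrorSig`). -/
def ThinMirrorSig (lam : ℝ) : Prop := CertificatesExistRightThinSig lam → CertificatesExistThinSig lam

/-! ## §7 `ThinMirrorSig` PROVED: 117's reflection argument on the thin strip (the thin strip and its boundary are mirror-symmetric) -/

section Mirror

variable {κ : Type} [Fintype κ]

/-- the thin strip is reflection-invariant. -/
theorem thinStrip_mirror_iff (xv R Hs : ℝ) (u : ℂ) : ThinStrip xv R Hs (mirrorPt xv u) ↔ ThinStrip xv R Hs u := by
  unfold ThinStrip
  rw [abs_mirrorPt_re_sub, mirrorPt_im]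

/-- its boundary likewise. -/
theorem thinStripBdry_mirror_iff (xv R Hs : ℝ) (u : ℂ) : ThinStripBdry xv R Hs (mirrorPt xv u) ↔ ThinStripBdry xv R Hs u := by
  unfold ThinStripBdry
  rw [abs_mirrorPt_re_sub, mirrorPt_im]

/-- thin (K) transfers to the mirrored family at the reflected child. -/
theorem kernelDomThin_mirror (xv R Hs : ℝ) (cs : κ → Cut) (w : ℂ) (σ : ℝ) (h : KernelDomThin xv R Hs cs w σ) :
    KernelDomThin xv R Hs (mirrorCuts xv cs) (mirrorPt xv w) σ := by
  intro u hu
  have hK := h (mirrorPt xv u) ((thinStrip_mirror_iff xv R Hs u).2 hu)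
  rw [← mirrorPt_mirrorPt xv u, cutNumer_mirror, farPairC_mirror]
  exact hK

/-- thin (K∂) transfers likewise. -/
theorem kernelDomThinBdry_mirror (xv R Hs : ℝ) (cs : κ → Cut) (w : ℂ) (σ : ℝ) (h : KernelDomThinBdry xv R Hs cs w σ) :
    KernelDomThinBdry xv R Hs (mirrorCuts xv cs) (mirrorPt xv w) σ := by
  intro u hu
  have hK := h (mirrorPt xv u) ((thinStripBdry_mirror_iff xv R Hs u).2 hu)
  rw [← mirrorPt_mirrorPt xv u, cutNumer_mirror, farPairC_mirror]
  exact hK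

/-- ★ (K) `ThinMirrorSig lam` HOLDS: thin certificates for ALL children from thin certificates for right children, by reflection (117's
`certificatesExistSig_of_right` verbatim with the thin names). -/
theorem certificatesExistThinSig_of_right (lam : ℝ) (hR : CertificatesExistRightThinSig lam) : CertificatesExistThinSig lam := by
  intro xv R s h Hs v w mult hs hsh h3 hHs0 hHR hv hY hYh ht htY hdrop hnest hmult
  rcases le_or_gt xv w.re with hright | hleft
  · exact hR xv R s h Hs v w mult hs hsh h3 hHs0 hHR hv hY hYh ht htY hdrop hnest hmult hright
  · -- reflect the child, certify on the right, reflect the certificate back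
    set w' := mirrorPt xv w with hw'
    have hw're : xv ≤ w'.re := by rw [hw', mirrorPt_re]; linarith
    have hnest' : (w'.re - xv) ^ 2 + w'.im ^ 2 ≤ v.im ^ 2 := by
      rw [hw', mirrorPt_re, mirrorPt_im]; nlinarith [hnest]
    obtain ⟨n, cs, σ, hadm, hpts, hK, hD⟩ :=
      hR xv R s h Hs v w' mult hs hsh h3 hHs0 hHR hv hY hYh (by rw [hw', mirrorPt_im]; exact ht) (by rw [hw', mirrorPt_im]; exact htY)
        (by rw [hw', mirrorPt_im]; exact hdrop) hnest' hmult hw're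
    have hww : mirrorPt xv w' = w := by rw [hw', mirrorPt_mirrorPt]
    refine ⟨n, mirrorCuts xv cs, σ, cutsAdmissible_mirror xv cs hadm, fun k => ?_, ?_, ?_⟩
    · rw [mirrorCuts_p xv cs hadm k, show w.im = w'.im by rw [hw', mirrorPt_im]]; exact hpts k
    · have := kernelDomThin_mirror xv R Hs cs w' σ hK; rwa [hww] at this
    · have := datumAlt_mirror xv lam s cs v w' hv mult σ hD; rwa [hww] at this

/-- so the named implication holds. -/
theorem thinMirrorSig (lam : ℝ) : ThinMirrorSig lam := certificatesExistThinSig_of_right lam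

end Mirror

end RhW08.SinkThin
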